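import Literature.MathematicalPhysics.QuantumFieldTheory.Balaban1983to89.T3OrbitAverage

/-!
# Route `PoincareLipschitz` (planner ym-r3-idea-2 g7, LINE 15), glue `TwoSidedOfConcentration` (stmt-QuantumFields-23535) —
# helper 2: the BOX-RESTRICTED `ℓ²` LINK PSEUDOMETRIC on `SU(N)^{bonds}`

The crux `BlockLipschitzL` measures pairs of configurations `U, U'` of one lattice by
`d_B(U,U') = (Σ_{b ∈ B} dist1(U_b U'_b⁻¹)²)^{1/2}` (`B` = the bonds of a box, written as an `if … then … else 0` sum), and the crux
`MesoscopicConcentrationL` by the same sum over ALL bonds.  This file records the elementary facts that make `d_B` a gauge-invariant,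
box-local, continuous pseudometric dominated by the full link metric: `d_B ≥ 0`, `d_B(U,U) = 0`, symmetry (`dist1 g⁻¹ = dist1 g`), the triangle
inequality (`dist1 (gh) ≤ dist1 g + dist1 h` bondwise and Minkowski in `ℓ²`), continuity in the first argument, invariance under gauge
transformations (`dist1 (h g h⁻¹) = dist1 g`), dependence on `U` only through `U|_B`, and `d_B ≤ d`.

Width seat ym-line-sfw-p2-w3 g30 (cell ym-idea-1, R3 family; free hands), `--supports stmt-QuantumFields-23535`.  Bookkeeping only; no crux, rung
(R3 is a RECORD rung) or summit is proved; the Yang–Mills mass gap is NOT proved.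
-/

set_option autoImplicit false

namespace Summit.QuantumFields.YangMills.Theorems.PoincareLipschitz.TwoSidedOfConcentration

open scoped BigOperators
open Literature.MathematicalPhysics.QuantumFieldTheory.Balaban1983to89

/-! ## §1 Minkowski's inequality for finite `ℓ²` sums of dominated non-negative families -/

/-- If `0 ≤ z ≤ x + y` termwise, then `√(Σ z²) ≤ √(Σ x²) + √(Σ y²)` (Cauchy–Schwarz). [folklore] -/
theorem sqrt_sum_sq_le_of_le_add {ι : Type*} (s : Finset ι) (x y z : ι → ℝ)
    (hz0 : ∀ i, 0 ≤ z i) (hz : ∀ i, z i ≤ x i + y i) :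
    Real.sqrt (∑ i ∈ s, z i ^ 2) ≤ Real.sqrt (∑ i ∈ s, x i ^ 2) + Real.sqrt (∑ i ∈ s, y i ^ 2) := by
  set A := Real.sqrt (∑ i ∈ s, x i ^ 2) with hA
  set B := Real.sqrt (∑ i ∈ s, y i ^ 2) with hB
  have hX0 : 0 ≤ ∑ i ∈ s, x i ^ 2 := Finset.sum_nonneg fun i _ => sq_nonneg _
  have hY0 : 0 ≤ ∑ i ∈ s, y i ^ 2 := Finset.sum_nonneg fun i _ => sq_nonneg _
  have hA0 : 0 ≤ A := Real.sqrt_nonneg _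
  have hB0 : 0 ≤ B := Real.sqrt_nonneg _
  have hzle : ∑ i ∈ s, z i ^ 2 ≤ ∑ i ∈ s, (x i + y i) ^ 2 :=
    Finset.sum_le_sum fun i _ => pow_le_pow_left₀ (hz0 i) (hz i) 2
  have hcs : ∑ i ∈ s, x i * y i ≤ A * B := by
    have h := Finset.sum_mul_sq_le_sq_mul_sq s x y
    calc ∑ i ∈ s, x i * y i ≤ |∑ i ∈ s, x i * y i| := le_abs_self _
      _ = Real.sqrt ((∑ i ∈ s, x i * y i) ^ 2) := (Real.sqrt_sq_eq_abs _).symm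
      _ ≤ Real.sqrt ((∑ i ∈ s, x i ^ 2) * ∑ i ∈ s, y i ^ 2) := Real.sqrt_le_sqrt h
      _ = A * B := by rw [hA, hB, Real.sqrt_mul hX0]
  have hexp : ∑ i ∈ s, (x i + y i) ^ 2 = ∑ i ∈ s, x i ^ 2 + 2 * ∑ i ∈ s, x i * y i + ∑ i ∈ s, y i ^ 2 := by
    simp only [add_sq, Finset.sum_add_distrib, Finset.mul_sum]
    refine congrArg₂ _ (congrArg₂ _ rfl (Finset.sum_congr rfl fun i _ => by ring)) rfl
  have hsqA : A ^ 2 = ∑ i ∈ s, x i ^ 2 := by rw [hA, Real.sq_sqrt hX0]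
  have hsqB : B ^ 2 = ∑ i ∈ s, y i ^ 2 := by rw [hB, Real.sq_sqrt hY0]
  have hle : ∑ i ∈ s, z i ^ 2 ≤ (A + B) ^ 2 := by
    calc ∑ i ∈ s, z i ^ 2 ≤ ∑ i ∈ s, (x i + y i) ^ 2 := hzle
      _ = A ^ 2 + 2 * ∑ i ∈ s, x i * y i + B ^ 2 := by rw [hexp, hsqA, hsqB]
      _ ≤ A ^ 2 + 2 * (A * B) + B ^ 2 := by linarith
      _ = (A + B) ^ 2 := by ring
  calc Real.sqrt (∑ i ∈ s, z i ^ 2) ≤ Real.sqrt ((A + B) ^ 2) := Real.sqrt_le_sqrt hle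
    _ = A + B := Real.sqrt_sq (add_nonneg hA0 hB0)

/-! ## §2 The box link pseudometric on `SU(N)^{bonds}` -/

section Box

variable {N : ℕ} [NeZero N] {P : Params} {k : ℕ} (w : PBond P k → Prop) [DecidablePred w]

/-- `dist1 ≥ 0` squared under the box cut-off: the summand is non-negative. [folklore] -/
theorem boxTerm_nonneg (U U' : GaugeField P k (Matrix.specialUnitaryGroup (Fin N) ℂ)) (b : PBond P k) :
    0 ≤ (if w b then GaugeGroup.dist1 (U b * (U' b)⁻¹) ^ 2 else 0) := by
  split_ifs
  · exact sq_nonneg _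
  · exact le_rfl

/-- The summand is the square of the cut-off bond distance `[b ∈ B]·dist1(U_b U'_b⁻¹)`. [folklore] -/
theorem boxTerm_eq_sq (U U' : GaugeField P k (Matrix.specialUnitaryGroup (Fin N) ℂ)) (b : PBond P k) :
    (if w b then GaugeGroup.dist1 (U b * (U' b)⁻¹) ^ 2 else 0) =
      (if w b then GaugeGroup.dist1 (U b * (U' b)⁻¹) else 0) ^ 2 := by
  split_ifs <;> simp

/-- `d_B(U,U') ≥ 0`. [folklore] -/
theorem boxLinkDist_nonneg (U U' : GaugeField P k (Matrix.specialUnitaryGroup (Fin N) ℂ)) :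
    0 ≤ Real.sqrt (∑ b : PBond P k, if w b then GaugeGroup.dist1 (U b * (U' b)⁻¹) ^ 2 else 0) :=
  Real.sqrt_nonneg _

/-- `d_B(U,U) = 0` (`dist1 1 = 0`). [folklore] -/
theorem boxLinkDist_self (U : GaugeField P k (Matrix.specialUnitaryGroup (Fin N) ℂ)) :
    Real.sqrt (∑ b : PBond P k, if w b then GaugeGroup.dist1 (U b * (U b)⁻¹) ^ 2 else 0) = 0 := by
  have h : ∀ b : PBond P k, (if w b then GaugeGroup.dist1 (U b * (U b)⁻¹) ^ 2 else 0) = 0 := by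
    intro b
    rw [mul_inv_cancel, GaugeGroup.dist1_one]
    simp
  simp_rw [h]
  simp

/-- Symmetry `d_B(U,U') = d_B(U',U)` (`dist1 g⁻¹ = dist1 g`). [folklore] -/
theorem boxLinkDist_comm (U U' : GaugeField P k (Matrix.specialUnitaryGroup (Fin N) ℂ)) :
    Real.sqrt (∑ b : PBond P k, if w b then GaugeGroup.dist1 (U b * (U' b)⁻¹) ^ 2 else 0) =
      Real.sqrt (∑ b : PBond P k, if w b then GaugeGroup.dist1 (U' b * (U b)⁻¹) ^ 2 else 0) := by
  have h : ∀ b : PBond P k, GaugeGroup.dist1 (U b * (U' b)⁻¹) = GaugeGroup.dist1 (U' b * (U b)⁻¹) := by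
    intro b
    rw [← GaugeGroup.dist1_inv (U b * (U' b)⁻¹), mul_inv_rev, inv_inv]
  simp_rw [h]

/-- Triangle inequality `d_B(U,U'') ≤ d_B(U,U') + d_B(U',U'')` (`dist1 (gh) ≤ dist1 g + dist1 h` bondwise, Minkowski). [folklore] -/
theorem boxLinkDist_triangle (U U' U'' : GaugeField P k (Matrix.specialUnitaryGroup (Fin N) ℂ)) :
    Real.sqrt (∑ b : PBond P k, if w b then GaugeGroup.dist1 (U b * (U'' b)⁻¹) ^ 2 else 0) ≤
      Real.sqrt (∑ b : PBond P k, if w b then GaugeGroup.dist1 (U b * (U' b)⁻¹) ^ 2 else 0) +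
        Real.sqrt (∑ b : PBond P k, if w b then GaugeGroup.dist1 (U' b * (U'' b)⁻¹) ^ 2 else 0) := by
  simp_rw [boxTerm_eq_sq w]
  refine sqrt_sum_sq_le_of_le_add Finset.univ _ _ _ (fun b => ?_) (fun b => ?_)
  · split_ifs
    · exact GaugeGroup.dist1_nonneg _
    · exact le_rfl
  · split_ifs
    · have h : U b * (U'' b)⁻¹ = (U b * (U' b)⁻¹) * (U' b * (U'' b)⁻¹) := by group
      rw [h]
      exact GaugeGroup.dist1_mul_le _ _
    · simp

/-- `U ↦ d_B(U,U')` is continuous (product topology; `dist1` continuous on `SU(N)`). [folklore] -/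
theorem continuous_boxLinkDist (U' : GaugeField P k (Matrix.specialUnitaryGroup (Fin N) ℂ)) :
    Continuous fun U : GaugeField P k (Matrix.specialUnitaryGroup (Fin N) ℂ) =>
      Real.sqrt (∑ b : PBond P k, if w b then GaugeGroup.dist1 (U b * (U' b)⁻¹) ^ 2 else 0) := by
  have hd : Continuous (GaugeGroup.dist1 : Matrix.specialUnitaryGroup (Fin N) ℂ → ℝ) :=
    UnitaryModel.continuous_opDist1.comp (Literature.MathematicalPhysics.QuantumLattice.continuous_fundamentalRep (Fin N))
  refine Real.continuous_sqrt.comp (continuous_finsetSum _ fun b _ => ?_)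
  by_cases hb : w b
  · simp only [hb, if_true]
    have hU : Continuous fun U : GaugeField P k (Matrix.specialUnitaryGroup (Fin N) ℂ) => U b := continuous_apply b
    exact (hd.comp (hU.mul continuous_const)).pow 2
  · simp only [hb, if_false]
    exact continuous_const

/-- Gauge invariance `d_B(U^u, U'^u) = d_B(U,U')` (`U^u_b U'^u_b⁻¹ = u(b₋)·U_b U'_b⁻¹·u(b₋)⁻¹` and `dist1` is a class function).
[cite: Balaban1985Averaging, (8) p.19] -/
theorem boxLinkDist_gaugeAct (u : GaugeTransf P k (Matrix.specialUnitaryGroup (Fin N) ℂ))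
    (U U' : GaugeField P k (Matrix.specialUnitaryGroup (Fin N) ℂ)) :
    Real.sqrt (∑ b : PBond P k, if w b then
        GaugeGroup.dist1 (GaugeField.gaugeAct u U b * (GaugeField.gaugeAct u U' b)⁻¹) ^ 2 else 0) =
      Real.sqrt (∑ b : PBond P k, if w b then GaugeGroup.dist1 (U b * (U' b)⁻¹) ^ 2 else 0) := by
  have h : ∀ b : PBond P k, GaugeGroup.dist1 (GaugeField.gaugeAct u U b * (GaugeField.gaugeAct u U' b)⁻¹) =
      GaugeGroup.dist1 (U b * (U' b)⁻¹) := by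
    intro b
    have hb : GaugeField.gaugeAct u U b * (GaugeField.gaugeAct u U' b)⁻¹ = u b.src * (U b * (U' b)⁻¹) * (u b.src)⁻¹ := by
      simp only [GaugeField.gaugeAct]
      group
    rw [hb, GaugeGroup.dist1_conj]
  simp_rw [h]

/-- Box locality: `d_B(U,V)` depends on `U` only through `U|_B`. [folklore] -/
theorem boxLinkDist_congr_left {U U'' : GaugeField P k (Matrix.specialUnitaryGroup (Fin N) ℂ)} (h : ∀ b, w b → U b = U'' b)
    (V : GaugeField P k (Matrix.specialUnitaryGroup (Fin N) ℂ)) :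
    Real.sqrt (∑ b : PBond P k, if w b then GaugeGroup.dist1 (U b * (V b)⁻¹) ^ 2 else 0) =
      Real.sqrt (∑ b : PBond P k, if w b then GaugeGroup.dist1 (U'' b * (V b)⁻¹) ^ 2 else 0) := by
  refine congrArg Real.sqrt (Finset.sum_congr rfl fun b _ => ?_)
  by_cases hb : w b
  · simp only [hb, if_true, h b hb]
  · simp only [hb, if_false]

/-- Domination by the full link metric: `d_B(U,U') ≤ d(U,U') = (Σ_{all b} dist1(U_b U'_b⁻¹)²)^{1/2}`. [folklore] -/
theorem boxLinkDist_le_linkDist (U U' : GaugeField P k (Matrix.specialUnitaryGroup (Fin N) ℂ)) :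
    Real.sqrt (∑ b : PBond P k, if w b then GaugeGroup.dist1 (U b * (U' b)⁻¹) ^ 2 else 0) ≤
      Real.sqrt (∑ b : PBond P k, GaugeGroup.dist1 (U b * (U' b)⁻¹) ^ 2) := by
  refine Real.sqrt_le_sqrt (Finset.sum_le_sum fun b _ => ?_)
  split_ifs
  · exact le_rfl
  · exact sq_nonneg _

/-- The quasi-inverse of a gauge transformation: `(U^{u⁻¹})^{u} = U` with `u⁻¹(x) = u(x)⁻¹`. [cite: Balaban1985Averaging, (8) p.19] -/
theorem gaugeAct_gaugeAct_inv (u : GaugeTransf P k (Matrix.specialUnitaryGroup (Fin N) ℂ))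
    (U : GaugeField P k (Matrix.specialUnitaryGroup (Fin N) ℂ)) :
    GaugeField.gaugeAct u (GaugeField.gaugeAct (fun x => (u x)⁻¹) U) = U := by
  funext b
  simp only [GaugeField.gaugeAct]
  group

end Box

end Summit.QuantumFields.YangMills.Theorems.PoincareLipschitz.TwoSidedOfConcentration
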